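/-
Origin: expansion seat `prover-pub-hodgecm-mc-binder-2-g14-0`, handover #S9 2026-08-20T12:17Z md5 0dd15b2722f2 (PKG 43ec738ee101 → 0dd15b2722f2; 142 l.; σ implicit; §1–§2 over `printedAtσ … σ` / `datumAtσ … σ`; proofs verbatim; NAME LIST: HodgeCM.Model.HypCensus.hdense_of_hκ) (`HOME/mc/pub-hodgecm-mc-binder-2/g14/s5b/HodgeCM/Model/HypCensus/DenseRange.lean`, md5 0dd15b2722f2, 142 lines);
landed by the gen-20 packager (p-g20) in gate run 51 REPLACES the earlier landed copy of `HodgeCM/Model/HypCensus/DenseRange.lean` (seat copy carried the packager Origin header of an earlier run (stripped)).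
-/
/-
Copyright (c) 2026. All rights reserved.
Released under Apache 2.0 license as described in the file LICENSE.
-/
import Summits.HodgeConjecture.HodgeCM.Model.HypCensus.DensePlaceEmb
import Summits.HodgeConjecture.HodgeCM.Model.HypCensus.DenseReduce

/-!
# (J-dense), step (iv-c) and the conclusion: `𝒮_∞^κ`-polynomials are printed insertions; `hdense` from `hκ`

Binder-2 lineage, rows 18/19 (`hyp12`/`hyp34`), field `dense` of `HypCoreW` — the residual `hdense` of #55/#56 DISCHARGED from the one
remaining (V-val) identity `hκ` (already a hypothesis of rows 18/19 through `ins_mem`, #51).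

Assembly of the (J-dense) chain (i)–(v) (#57–#63) with the per-place classification #64–#69:

* `placeProducts_subset_range_insPoly` — every place product of per-place letter-eigenvectors is `insPoly` of a pure tensor of printed
  vectors (#69 `mem_range_embOf_of_mem_jointEigenspace` place by place + #4 `insPoly_tprod`);
* `detIsotypicPolys_subset_range_insPoly` — every `det`-isotypic polynomial of the pin (#61) is a printed insertion (#63);
* **`hpoly_of_hκ`** — #60's polynomial-level hypothesis `hpoly` from `hκ`: for `G ∈ pinIsotypicPolys` and `f ∈ 𝒮(𝔸_f^6)`,
  `E(follandFock 𝔢 G ⊗ f) = ins f φ` for a printed `φ`, so it lies in the span of the inserted printed vectors (no closure needed);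
* **`hdense_of_hκ`** — #55's hypothesis `hdense` (the census field `dense` at the W pin of record) from `hκ` (#60 `hdense_of_polys`).

[GoodmanWallach2009 §§4.2.1, 5.2.1; Folland1989 Ch. 4 §5; KashiwaraVergne1978 Ch. III §5; folklore]  Nothing here is a claim of PerL/QW8.

**(T12)/(B1′) second table.** RULING S5b (B1′) re-base: §1–§2 are stated for the census `datumAtσ … σ`, `σ` IMPLICIT (`σ = 1` = the statements of record; the (34) row
consumes them at `σ = sigma34 S`).
-/

noncomputable section

open NumberField NumberField.InfinitePlace IsDedekindDomain
open scoped Matrix Classical TensorProduct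
open MvPolynomial
open Literature.NumberTheory.Automorphic Literature.NumberTheory.Automorphic.UnitaryGroup Literature.NumberTheory.Weil1964
open Literature.RepresentationTheory.KonnoKonno2007 Literature.RepresentationTheory.KonnoKonno2007.RealDualPair
open Literature.NumberTheory.GelbartRogawski1991 Literature.NumberTheory.GelbartRogawski1991.UnitaryDualPair
open Literature.Analysis.SegalBargmann Literature.RepresentationTheory
open HodgeCM HodgeCM.Model HodgeCM.Adelic
open HodgeCM.PerL34.Fock HodgeCM.PerL34.Fock.PrintDict

namespace HodgeCM.Model.HypCensus

section Pin

variable {L : CMField} {ι₁ : L →+* ℂ} (V : HermSpace3 L ι₁) (S : StubTree.SeesawDatum L)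
variable
  (hGR : (cmSplittingDatum (L : Type) finProdFinEquiv (frameD V) (frameD_real V) (frameD_ne V) (dW S) (dW_real S) (dW_ne S)).CompatibleSplitting)
  (η : CMAdelic (L : Type) (frameD V) × CMAdelic (L : Type) (dW S) →* ℂˣ)
  (hη : ∀ γU ∈ CMRat (L : Type) (frameD V), ∀ γ ∈ CMRat (L : Type) (dW S), η (γU, γ) = 1)
  (hηc : Continuous fun p => ((η p : ℂˣ) : ℂ))
  (hW : (∀ j, 0 < (ι₁ ((dW S) j)).re) ∨ ∀ j, (ι₁ ((dW S) j)).re < 0)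
variable (jD : InfinitePlace (L : Type) → HodgeCM.PerL34.Fock.EqVar → Fin 6) (m₁ m₂ : InfinitePlace (L : Type) → ℤ)
variable {σ : InfinitePlace (L : Type) → Equiv.Perm (Fin 2)}

/-! ## §1 Place products and `det`-isotypic polynomials are printed insertions -/

/-- **every place product of per-place letter-eigenvectors is `insPoly` of a pure tensor of printed vectors.** -/
theorem placeProducts_subset_range_insPoly :
    placeProducts (pinPlaceOp V S) (pinPlaceEig V S) ⊆
      (LinearMap.range (insPoly (cmPlacesEquiv (L : Type))
        (embOf (L : Type) (frameD V) (frameD_real V) (dW S) (dW_real S) ι₁ (datumAtσ V S jD (jIOf V S hW) σ) m₁ m₂)) :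
          Set (MvPolynomial (Fin 6 × {v : InfinitePlace ↥(maximalRealSubfield L) // v.IsReal}) ℂ)) := by
  rintro _ ⟨p, hp, rfl⟩
  have hx : ∀ v : {v : InfinitePlace ↥(maximalRealSubfield L) // v.IsReal}, ∃ x,
      embOf (L : Type) (frameD V) (frameD_real V) (dW S) (dW_real S) ι₁ (datumAtσ V S jD (jIOf V S hW) σ) m₁ m₂
        ((cmPlacesEquiv (L : Type)).symm v) x = p v := fun v =>
    LinearMap.mem_range.mp (mem_range_embOf_of_mem_jointEigenspace V S hW jD m₁ m₂ ((cmPlacesEquiv (L : Type)).symm v)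
      (by rw [Equiv.apply_symm_apply]; exact hp v))
  choose x hx using hx
  refine ⟨PiTensorProduct.tprod ℂ ((Equiv.piCongrLeft' (fun b => ((printedAtσ V S hW jD m₁ m₂ σ).loc b).M)
    (cmPlacesEquiv (L : Type))).symm x), ?_⟩
  rw [insPoly_tprod]
  refine Finset.prod_congr rfl fun v _ => ?_
  rw [← hx v]
  have h1 := congrFun ((Equiv.piCongrLeft' (fun b => ((printedAtσ V S hW jD m₁ m₂ σ).loc b).M) (cmPlacesEquiv (L : Type))).apply_symm_apply x) v
  rw [Equiv.piCongrLeft'_apply] at h1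
  exact congrArg (rename (atPlace v)) (congrArg _ h1)

/-- **every `det`-isotypic polynomial of the pin is a printed insertion** (#63 + the above). -/
theorem detIsotypicPolys_subset_range_insPoly :
    detIsotypicPolys V S ⊆
      (LinearMap.range (insPoly (cmPlacesEquiv (L : Type))
        (embOf (L : Type) (frameD V) (frameD_real V) (dW S) (dW_real S) ι₁ (datumAtσ V S jD (jIOf V S hW) σ) m₁ m₂)) :
          Set (MvPolynomial (Fin 6 × {v : InfinitePlace ↥(maximalRealSubfield L) // v.IsReal}) ℂ)) := fun _ hG =>
  Submodule.span_le.mpr (placeProducts_subset_range_insPoly V S hW jD m₁ m₂) (mem_span_placeProducts_of_mem_detIsotypicPolys V S hG)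

/-! ## §2 `hpoly` and `hdense` from `hκ` -/

/-- **#60's `hpoly` FROM `hκ`**: for every isotypic polynomial `G` of the pin and every finite datum `f`, `E(follandFock 𝔢 G ⊗ f)` is an
inserted printed vector `ins f φ`, hence lies in (the `Θ`-closure of) the span of the inserted printed vectors. -/
theorem hpoly_of_hκ
    (hκ : ∀ k : ↥(KInfty V),
      ((η (kPair V S ι₁ V.sylvesterFrame (sylvesterFrame_formCongr V) k) : ℂˣ) : ℂ) *
        ((pinLetterChar V S hGR hW (kVLetters V S (lett V S k)) : Circle) : ℂ) * dVIota V S (lett V S k (cmPlace (L : Type) ι₁)) =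
      ((UnitaryGroup.archKappa (L : Type) V.Hm ι₁ V.sylvesterFrame (sylvesterFrame_formCongr V) k : ℂˣ) : ℂ))
    (G : MvPolynomial (Fin 6 × {v : InfinitePlace ↥(maximalRealSubfield L) // v.IsReal}) ℂ) (hG : G ∈ pinIsotypicPolys V S hGR η hW)
    (f : FinSB ↥(maximalRealSubfield L) (Fin 6)) :
    toTop (wmInputCM₂g V S hGR η hη hηc ι₁ V.sylvesterFrame (sylvesterFrame_formCongr V))
        (piSchwartzBruhatEquiv (↥(maximalRealSubfield L)) (Fin 6)
          (follandFock (cmBigFrame (L : Type) finProdFinEquiv (frameD V) (frameD_real V) (frameD_ne V) (dW S) (dW_real S)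
            (dW_ne S) ι₁) G ⊗ₜ f)) ∈
      closure (toTop (wmInputCM₂g V S hGR η hη hηc ι₁ V.sylvesterFrame (sylvesterFrame_formCongr V)) ''
        (Submodule.span ℂ (Set.range fun q : FinSB ↥(maximalRealSubfield L) (Fin 6) × (printedAtσ V S hW jD m₁ m₂ σ).F =>
          ins (L : Type) (frameD V) (frameD_real V) (frameD_ne V) (dW S) (dW_real S) (dW_ne S) ι₁ (datumAtσ V S jD (jIOf V S hW) σ)
            m₁ m₂ q.1 q.2) : Set (CMSchwartz (L : Type) 6))) := by
  have hG' : G ∈ detIsotypicPolys V S := (mem_pinIsotypicPolys_iff_of_hκ V S hGR η hW hκ).mp hG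
  obtain ⟨φ, hφ⟩ := detIsotypicPolys_subset_range_insPoly V S hW jD m₁ m₂ hG'
  have hmem : ins (L : Type) (frameD V) (frameD_real V) (frameD_ne V) (dW S) (dW_real S) (dW_ne S) ι₁ (datumAtσ V S jD (jIOf V S hW) σ)
      m₁ m₂ f φ ∈ (Submodule.span ℂ (Set.range fun q : FinSB ↥(maximalRealSubfield L) (Fin 6) × (printedAtσ V S hW jD m₁ m₂ σ).F =>
        ins (L : Type) (frameD V) (frameD_real V) (frameD_ne V) (dW S) (dW_real S) (dW_ne S) ι₁ (datumAtσ V S jD (jIOf V S hW) σ)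
          m₁ m₂ q.1 q.2) : Set (CMSchwartz (L : Type) 6)) :=
    Submodule.subset_span ⟨(f, φ), rfl⟩
  refine subset_closure ⟨_, hmem, ?_⟩
  rw [← hφ]
  rfl

include hW in
/-- **THE CENSUS FIELD `dense` AT THE W PIN OF RECORD, FROM `hκ`** (rows 18/19, junction (J-dense)): #55's hypothesis `hdense` holds for
every `Φ ∈ W₀.SK` as soon as the (V-val) identity `hκ` does — (i)(ii) #57, (iii) #58/#59, (iv) #61–#69, (v) #60. -/
theorem hdense_of_hκ
    (hκ : ∀ k : ↥(KInfty V),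
      ((η (kPair V S ι₁ V.sylvesterFrame (sylvesterFrame_formCongr V) k) : ℂˣ) : ℂ) *
        ((pinLetterChar V S hGR hW (kVLetters V S (lett V S k)) : Circle) : ℂ) * dVIota V S (lett V S k (cmPlace (L : Type) ι₁)) =
      ((UnitaryGroup.archKappa (L : Type) V.Hm ι₁ V.sylvesterFrame (sylvesterFrame_formCongr V) k : ℂˣ) : ℂ))
    (Φ : CMSchwartz (L : Type) 6)
    (hΦ : Φ ∈ (wmInputCM₂g V S hGR η hη hηc ι₁ V.sylvesterFrame (sylvesterFrame_formCongr V)).SK) :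
    toTop (wmInputCM₂g V S hGR η hη hηc ι₁ V.sylvesterFrame (sylvesterFrame_formCongr V)) Φ ∈
      closure (toTop (wmInputCM₂g V S hGR η hη hηc ι₁ V.sylvesterFrame (sylvesterFrame_formCongr V)) ''
        (Submodule.span ℂ (Set.range fun q : FinSB ↥(maximalRealSubfield L) (Fin 6) × (printedAtσ V S hW jD m₁ m₂ σ).F =>
          ins (L : Type) (frameD V) (frameD_real V) (frameD_ne V) (dW S) (dW_real S) (dW_ne S) ι₁ (datumAtσ V S jD (jIOf V S hW) σ)
            m₁ m₂ q.1 q.2) : Set (CMSchwartz (L : Type) 6))) :=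
  hdense_of_polys V S hGR η hη hηc hW jD m₁ m₂ (fun G hG f => hpoly_of_hκ V S hGR η hη hηc hW jD m₁ m₂ hκ G hG f) Φ hΦ

end Pin

end HodgeCM.Model.HypCensus

end
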